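import Mathlib
import Summits.Ventures.PercRepro2.TypedSwitchingPrimed

/-!
# The sign form of a two-bit switching inequality, for arbitrary bits (blind cell PercRepro2,
p3 g11, 2026-08-27; `proofs/P3-M9.md` §1 and §5 (G1))

`TypedSwitchingPrimed` treats the six-bit states of four points.  The identity behind it needs
nothing of the bits: for ANY two Boolean functions `a b` of a configuration (the «pair bits» — e.g.
«the set `P` lies in one block», «the set `T` lies in one block») and ANY predicate `sep x y` of the
two reflected copies that is symmetric in them,

  `c(sep · (a x − a y)·(b x − b y)) = 2·(c(sep ∧ a x ∧ b x) − c(sep ∧ a x ∧ b y))`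

(`typedCount_sign_eq`), and the exact-class difference `c(sep ∧ a x ∧ ¬a y ∧ b x ∧ ¬b y) −
c(sep ∧ a x ∧ ¬a y ∧ ¬b x ∧ b y)` equals the same quantity (`typedCount_exact_eq_primed`): the
classes where a bit is set in both copies cancel, one of them after `typedCount_swap12`.  So every
«two-bit switching move» `c(a only in x, b only in x) ≤ c(a only in x, b only in y)` under a
symmetric separation is EQUIVALENT to the negative correlation of the two bits' colour preferences
given the separation (`typedCount_two_bit_iff_sign`) — the shape of the generalisation (G1) of m9
to vertex sets.  Own work; standard axioms.
-/

namespace Summit.Ventures.PercRepro2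

namespace CovForm

namespace PairHarris

open Classical TypedA3

section General

variable {E : Type*} [Fintype E] [DecidableEq E] {R : Type*} [Field R]

/-- The `0/1` indicator of a Boolean in `R`. -/
noncomputable def bitR (b : Bool) : R := if b = true then (1 : R) else 0

/-- The sign kernel of two bits under a separation: `g w · 1[sep x y] · (a x − a y)·(b x − b y)`. -/
noncomputable def kerSignBits (sep : Config E → Config E → Prop) (a b : Config E → Bool)
    (g : Config E → R) (x y w : Config E) : R :=
  g w * (if sep x y then (1 : R) else 0) *
    ((bitR (a x) - bitR (a y)) * (bitR (b x) - bitR (b y)))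

/-- The primed source kernel `g w · 1[sep x y ∧ a x ∧ b x]`. -/
noncomputable def kerSrcBits (sep : Config E → Config E → Prop) (a b : Config E → Bool)
    (g : Config E → R) (x y w : Config E) : R :=
  g w * (if sep x y ∧ a x = true ∧ b x = true then (1 : R) else 0)

/-- The primed target kernel `g w · 1[sep x y ∧ a x ∧ b y]`. -/
noncomputable def kerTgtBits (sep : Config E → Config E → Prop) (a b : Config E → Bool)
    (g : Config E → R) (x y w : Config E) : R :=
  g w * (if sep x y ∧ a x = true ∧ b y = true then (1 : R) else 0)

/-- The exact source class `g w · 1[sep ∧ a x ∧ ¬a y ∧ b x ∧ ¬b y]` («`a` and `b` only in `x`»). -/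
noncomputable def kerExactSrcBits (sep : Config E → Config E → Prop) (a b : Config E → Bool)
    (g : Config E → R) (x y w : Config E) : R :=
  g w * (if sep x y ∧ a x = true ∧ a y = false ∧ b x = true ∧ b y = false then (1 : R) else 0)

/-- The exact target class `g w · 1[sep ∧ a x ∧ ¬a y ∧ ¬b x ∧ b y]` («`a` only in `x`, `b` only in
`y`»). -/
noncomputable def kerExactTgtBits (sep : Config E → Config E → Prop) (a b : Config E → Bool)
    (g : Config E → R) (x y w : Config E) : R :=
  g w * (if sep x y ∧ a x = true ∧ a y = false ∧ b x = false ∧ b y = true then (1 : R) else 0)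

/-- The «both» class `g w · 1[sep ∧ a x ∧ b x ∧ b y]`. -/
noncomputable def kerBothBits (sep : Config E → Config E → Prop) (a b : Config E → Bool)
    (g : Config E → R) (x y w : Config E) : R :=
  g w * (if sep x y ∧ a x = true ∧ b x = true ∧ b y = true then (1 : R) else 0)

/-- The asymmetric class `g w · 1[sep ∧ a x ∧ a y ∧ b x ∧ ¬b y]`. -/
noncomputable def kerAsymBits (sep : Config E → Config E → Prop) (a b : Config E → Bool)
    (g : Config E → R) (x y w : Config E) : R :=
  g w * (if sep x y ∧ a x = true ∧ a y = true ∧ b x = true ∧ b y = false then (1 : R) else 0)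

omit [Fintype E] [DecidableEq E] in
/-- Pointwise: `Src = ExactSrc + Both + Asym`. -/
lemma kerSrcBits_eq (sep : Config E → Config E → Prop) (a b : Config E → Bool)
    (g : Config E → R) (x y w : Config E) :
    kerSrcBits sep a b g x y w = kerExactSrcBits sep a b g x y w + kerBothBits sep a b g x y w +
      kerAsymBits sep a b g x y w := by
  unfold kerSrcBits kerExactSrcBits kerBothBits kerAsymBits
  by_cases hs : sep x y <;> cases a x <;> cases a y <;> cases b x <;> cases b y <;> simp [hs]

omit [Fintype E] [DecidableEq E] in
/-- Pointwise, under the symmetry of `sep`: `Tgt = ExactTgt + Both + Asym∘swap`. -/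
lemma kerTgtBits_eq (sep : Config E → Config E → Prop) (hsep : ∀ x y, sep x y ↔ sep y x)
    (a b : Config E → Bool) (g : Config E → R) (x y w : Config E) :
    kerTgtBits sep a b g x y w = kerExactTgtBits sep a b g x y w + kerBothBits sep a b g x y w +
      kerAsymBits sep a b g y x w := by
  unfold kerTgtBits kerExactTgtBits kerBothBits kerAsymBits
  rw [show sep y x ↔ sep x y from (hsep y x)]
  by_cases hs : sep x y <;> cases a x <;> cases a y <;> cases b x <;> cases b y <;> simp [hs]

omit [Fintype E] [DecidableEq E] in
/-- Pointwise: the sign kernel is `(Src − Tgt) + (Src − Tgt)∘swap`, under the symmetry of `sep`. -/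
lemma kerSignBits_eq (sep : Config E → Config E → Prop) (hsep : ∀ x y, sep x y ↔ sep y x)
    (a b : Config E → Bool) (g : Config E → R) (x y w : Config E) :
    kerSignBits sep a b g x y w = (kerSrcBits sep a b g x y w - kerTgtBits sep a b g x y w) +
      (kerSrcBits sep a b g y x w - kerTgtBits sep a b g y x w) := by
  unfold kerSignBits kerSrcBits kerTgtBits bitR
  rw [show sep y x ↔ sep x y from (hsep y x)]
  by_cases hs : sep x y <;> cases a x <;> cases a y <;> cases b x <;> cases b y <;> simp [hs]

/-- **The exact classes and the primed classes have the same difference.** -/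
theorem typedCount_exact_eq_primed (F : Finset E) (z : Config E) (τ : E → ℕ)
    (sep : Config E → Config E → Prop) (hsep : ∀ x y, sep x y ↔ sep y x)
    (a b : Config E → Bool) (g : Config E → R) :
    typedCount F z τ (kerExactSrcBits sep a b g) - typedCount F z τ (kerExactTgtBits sep a b g) =
      typedCount F z τ (kerSrcBits sep a b g) - typedCount F z τ (kerTgtBits sep a b g) := by
  have h1 : typedCount F z τ (kerSrcBits sep a b g) =
      typedCount F z τ (kerExactSrcBits sep a b g) + typedCount F z τ (kerBothBits sep a b g) +
        typedCount F z τ (kerAsymBits sep a b g) := by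
    rw [← typedCount_add', ← typedCount_add']
    exact typedCount_congr' F z τ _ _ (kerSrcBits_eq sep a b g)
  have h2 : typedCount F z τ (kerTgtBits sep a b g) =
      typedCount F z τ (kerExactTgtBits sep a b g) + typedCount F z τ (kerBothBits sep a b g) +
        typedCount F z τ (kerAsymBits sep a b g) := by
    rw [← typedCount_swap12 F z τ (kerAsymBits sep a b g), ← typedCount_add', ← typedCount_add']
    exact typedCount_congr' F z τ _ _ (kerTgtBits_eq sep hsep a b g)
  rw [h1, h2]; ring

/-- **The sign form.**  `c(sep·(a x − a y)(b x − b y)) = 2·(c(sep ∧ a x ∧ b x) − c(sep ∧ a x ∧ b y))`. -/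
theorem typedCount_sign_eq (F : Finset E) (z : Config E) (τ : E → ℕ)
    (sep : Config E → Config E → Prop) (hsep : ∀ x y, sep x y ↔ sep y x)
    (a b : Config E → Bool) (g : Config E → R) :
    typedCount F z τ (kerSignBits sep a b g) =
      2 * (typedCount F z τ (kerSrcBits sep a b g) - typedCount F z τ (kerTgtBits sep a b g)) := by
  have hs : typedCount F z τ (fun x y w => kerSrcBits sep a b g y x w - kerTgtBits sep a b g y x w) =
      typedCount F z τ (fun x y w => kerSrcBits sep a b g x y w - kerTgtBits sep a b g x y w) :=
    typedCount_swap12 F z τ (fun x y w => kerSrcBits sep a b g x y w - kerTgtBits sep a b g x y w)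
  have hd : typedCount F z τ (fun x y w => kerSrcBits sep a b g x y w - kerTgtBits sep a b g x y w) =
      typedCount F z τ (kerSrcBits sep a b g) - typedCount F z τ (kerTgtBits sep a b g) := by
    rw [sub_eq_add_neg, ← typedCount_neg', ← typedCount_add']
    exact typedCount_congr' F z τ _ _ (fun x y w => by simp [sub_eq_add_neg])
  rw [typedCount_congr' F z τ _ _ (kerSignBits_eq sep hsep a b g), typedCount_add', hs, hd]; ring

end General

section Iff

variable {E : Type*} [Fintype E] [DecidableEq E] {R : Type*} [Field R] [LinearOrder R]
  [IsStrictOrderedRing R]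

/-- **A two-bit switching move ⟺ its primed form ⟺ its sign form.**  Under a symmetric separation
`sep`: `c(a, b only in x) ≤ c(a only in x, b only in y)` iff `c(sep ∧ a x ∧ b x) ≤ c(sep ∧ a x ∧ b y)`
iff the signed count `Σ sep·(a x − a y)(b x − b y)` is `≤ 0`. -/
theorem typedCount_two_bit_iff_sign (F : Finset E) (z : Config E) (τ : E → ℕ)
    (sep : Config E → Config E → Prop) (hsep : ∀ x y, sep x y ↔ sep y x)
    (a b : Config E → Bool) (g : Config E → R) :
    (typedCount F z τ (kerExactSrcBits sep a b g) ≤ typedCount F z τ (kerExactTgtBits sep a b g) ↔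
      typedCount F z τ (kerSrcBits sep a b g) ≤ typedCount F z τ (kerTgtBits sep a b g)) ∧
    (typedCount F z τ (kerSrcBits sep a b g) ≤ typedCount F z τ (kerTgtBits sep a b g) ↔
      typedCount F z τ (kerSignBits sep a b g) ≤ 0) := by
  have h := typedCount_exact_eq_primed F z τ sep hsep a b g
  have h2 := typedCount_sign_eq F z τ sep hsep a b g
  refine ⟨⟨fun hle => ?_, fun hle => ?_⟩, ⟨fun hle => ?_, fun hle => ?_⟩⟩
  · have := sub_nonpos.mpr hle; rw [h] at this; exact sub_nonpos.mp this
  · have := sub_nonpos.mpr hle; rw [← h] at this; exact sub_nonpos.mp this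
  · rw [h2]; have := sub_nonpos.mpr hle; nlinarith
  · rw [h2] at hle
    have : typedCount F z τ (kerSrcBits sep a b g) - typedCount F z τ (kerTgtBits sep a b g) ≤ 0 := by
      nlinarith
    exact sub_nonpos.mp this

end Iff

end PairHarris

end CovForm

end Summit.Ventures.PercRepro2
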